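import Literature.Analysis.FluidPDE.DriftHeatLocalClass
import Literature.Analysis.FluidPDE.ParabolicHarnackDrift
import HarnessLib

/-!
# Consequences of the interior Harnack inequality for `uₜ + a·∇u − Δu = 0`: oscillation decay
# and Harnack chains

Analysis/FluidPDE proofs-and-glue file on the path from the named fact
`Literature.Analysis.FluidPDE.Lieberman1996_harnack_drift` (Lieberman 1996, Theorem 6.27: the
interior parabolic Harnack inequality with bounded measurable drift, rendered for the elementary
time-integrated class) to KNSS 2009, Lemma 2.1 (`KNSS2009_lemma21`, stability of the strong
maximum principle on a bounded domain). For the local class `IsDriftHeatSolutionOn a w A (0,T] Ω`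
of `DriftHeatLocalClass` it proves the two classical consequences of a pointwise Harnack
inequality `sup_{Θ(R/2)} w ≤ C inf_{Q(R)} w` on cylinders `Q((y,s), 4R) ⊆ Ω × (0,T]`:

* **oscillation decay** (Moser; Lieberman 1996, proof of Theorem 6.28): applied to `M₄ − w` and
  `w − m₄`, Harnack gives `osc_{Q(r)} w ≤ (1 − 1/C) osc_{Q(4r)} w` on top-aligned cylinders
  (`IsHarnackConstFor.osc_step`), hence `osc_{Q(ρ/4ʲ)} w ≤ (1 − 1/C)ʲ (M − m)` for a solution with
  `m ≤ w ≤ M` (`IsHarnackConstFor.osc_iterate`) — a modulus of continuity **backwards in time up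
  to the final time `T`**, uniform in the class;
* **Harnack chains** (Lieberman 1996, Theorem 6.25, "the chaining argument"): along points
  `Z₀, …, Zₙ` with `|Zᵢ₊₁ − Zᵢ| < R`, `B̄(Zᵢ, 4R) ⊆ Ω`, and times `σ₀ < σ₁ < … < σₙ` admitting tops
  `sᵢ` with `σᵢ ∈ (sᵢ − 5R²/4, sᵢ − R²)`, `σᵢ₊₁ ∈ (sᵢ − R², sᵢ)`, a nonnegative solution satisfies
  `w(σ₀, Z₀) ≤ Cⁿ w(σₙ, Zₙ)` (`IsHarnackConstFor.chain`).

`IsHarnackConstFor E A R₀ C` names the property "`C` is a Harnack constant for drift bound `A`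
and radii `≤ R₀`" (the matrix of `Lieberman1996_harnack_drift`), so that the fact reads
`∀ A R₀ > 0, ∃ C > 0, IsHarnackConstFor E A R₀ C` (`Lieberman1996_harnack_drift.exists_const`,
with `C ≥ 1`).

Verdict clean-up (2026-08-16): the named fact `Lieberman1996_harnack_drift` is **refuted as
stated** (`not_Lieberman1996_harnack_drift`, `ParabolicHarnackDriftRefutation`: its cylinders
`Θ(R/2) = B(y,R/2) × (s − 5R²/4, s − R²)` and `Q(R)` are adjacent in time, a misreading of
Lieberman's `Θ(R) = Q((y, s − 4R²), R)`, Ch. VI §6, p. 122) and is kept in `ParabolicHarnackDrift`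
only under `@[deprecated]`; consequently `Lieberman1996_harnack_drift.exists_const` below is a
correct but vacuous implication for nontrivial `E`, kept unchanged for its importers, with
`linter.deprecated` switched off for it alone. The corrected statement (waiting time `3R²`:
`Θ(R/2) = B(y,R/2) × (s − 17R²/4, s − 4R²)`) is the proved fact `Lieberman1996_harnack_drift_gap`
(`ParabolicHarnackDriftGap`, `Lieberman1996_harnack_drift_gap_holds` in
`ParabolicHarnackDriftGapProofs`), whose constant-extraction lemma is
`Lieberman1996_harnack_drift_gap.exists_const` (`KNSSLemma21OfHarnackGap`). The theorems about
`IsHarnackConstFor` in this file are unconditional statements about any constant with that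
property and are unaffected.

## References

* G. M. Lieberman, *Second Order Parabolic Differential Equations*, World Scientific (1996),
  Ch. VI §7, Theorems 6.25, 6.27, 6.28. [Lieberman1996]
* J. Moser, *A Harnack inequality for parabolic differential equations*, Comm. Pure Appl. Math.
  17 (1964) 101–134.
-/

noncomputable section

open MeasureTheory Set Function Metric InnerProductSpace
open scoped Laplacian

namespace Literature.Analysis.FluidPDE

section HarnackConst

variable (E : Type*) [NormedAddCommGroup E] [InnerProductSpace ℝ E] [FiniteDimensional ℝ E]
  [MeasurableSpace E]

/-- **"`C` is an interior Harnack constant for drift bound `A` and radii `≤ R₀`"**: the matrix of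
the named fact `Lieberman1996_harnack_drift` (Lieberman 1996, Theorem 6.27, for
`uₜ + a·∇u − Δu = 0` in the elementary time-integrated class on `Ω × (0, T]`): for every open
`Ω`, every jointly measurable drift with `‖a‖ ≤ A` on `(0,T] × Ω`, every solution `u` of the
class and every cylinder `Q((y,s),4R)` (`0 < R ≤ R₀`, `B̄(y,4R) ⊆ Ω`, `16R² < s ≤ T`) on which
`u ≥ 0`, `u(t₁,x₁) ≤ C u(t₂,x₂)` for `(x₁,t₁) ∈ Θ(R/2) = B(y,R/2) × (s − 5R²/4, s − R²)`,
`(x₂,t₂) ∈ Q(R) = B(y,R) × (s − R², s)`. [cite: Lieberman1996, Ch. VI Thm 6.27] -/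
def IsHarnackConstFor (A R₀ C : ℝ) : Prop :=
  ∀ ⦃Ω : Set E⦄ ⦃T : ℝ⦄ ⦃a : ℝ → E → E⦄ ⦃u : ℝ → E → ℝ⦄,
    IsOpen Ω →
    Measurable (uncurry a) → (∀ t ∈ Ioc 0 T, ∀ x ∈ Ω, ‖a t x‖ ≤ A) →
    (∀ t ∈ Ioc 0 T, ContDiffOn ℝ 2 (u t) Ω) →
    ContinuousOn (fun p : ℝ × E => fderiv ℝ (u p.1) p.2) (Ioc 0 T ×ˢ Ω) →
    ContinuousOn (fun p : ℝ × E => (Δ (u p.1)) p.2) (Ioc 0 T ×ˢ Ω) →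
    (∀ x ∈ Ω, ∀ s t : ℝ, 0 < s → s ≤ t → t ≤ T →
      u t x - u s x = ∫ r in s..t, ((Δ (u r)) x - fderiv ℝ (u r) x (a r x))) →
    ∀ ⦃y : E⦄ ⦃s R : ℝ⦄, 0 < R → R ≤ R₀ → closedBall y (4 * R) ⊆ Ω →
      16 * R ^ 2 < s → s ≤ T →
      (∀ t ∈ Ioo (s - 16 * R ^ 2) s, ∀ x ∈ ball y (4 * R), 0 ≤ u t x) →
      ∀ ⦃t₁ : ℝ⦄ ⦃x₁ : E⦄ ⦃t₂ : ℝ⦄ ⦃x₂ : E⦄,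
        t₁ ∈ Ioo (s - 5 / 4 * R ^ 2) (s - R ^ 2) → x₁ ∈ ball y (R / 2) →
        t₂ ∈ Ioo (s - R ^ 2) s → x₂ ∈ ball y R →
        u t₁ x₁ ≤ C * u t₂ x₂

variable {E}

-- names the `@[deprecated]` record `Lieberman1996_harnack_drift` of `ParabolicHarnackDrift.lean` on purpose: a (now
-- vacuous) consumer kept for its importers (verdict clean-up 2026-08-16); REMOVE-WHEN the record is deleted there
set_option linter.deprecated false in
/-- The named fact `Lieberman1996_harnack_drift` provides, for every drift bound and radius
bound, a Harnack constant, which may be taken `≥ 1` (enlarge `C` to `max C 1`; the right-hand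
side is nonnegative). (Vacuous for nontrivial `E` since the verdict clean-up of 2026-08-16: the
hypothesis is the deprecated fact refuted by `not_Lieberman1996_harnack_drift`; the non-vacuous
counterpart is `Lieberman1996_harnack_drift_gap.exists_const`, see the module docstring.)
[cite: Lieberman1996, Ch. VI Thm 6.27] -/
theorem Lieberman1996_harnack_drift.exists_const (h : Lieberman1996_harnack_drift E) (A : ℝ)
    {R₀ : ℝ} (hR₀ : 0 < R₀) : ∃ C : ℝ, 1 ≤ C ∧ IsHarnackConstFor E A R₀ C := by
  obtain ⟨C, -, hC⟩ := @h A R₀ hR₀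
  refine ⟨max C 1, le_max_right _ _, ?_⟩
  intro Ω T a u hΩ ham haA hu2 hDu hΔu hequ y s R hR hRR₀ hB hs hsT hpos t₁ x₁ t₂ x₂ ht₁ hx₁ ht₂ hx₂
  have h1 := hC hΩ ham haA hu2 hDu hΔu hequ hR hRR₀ hB hs hsT hpos ht₁ hx₁ ht₂ hx₂
  have h2 : 0 ≤ u t₂ x₂ := by
    refine hpos t₂ ⟨?_, ht₂.2⟩ x₂ (ball_subset_ball (by linarith) hx₂)
    have : 0 < R ^ 2 := by positivity
    linarith [ht₂.1]
  calc u t₁ x₁ ≤ C * u t₂ x₂ := h1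
    _ ≤ max C 1 * u t₂ x₂ := mul_le_mul_of_nonneg_right (le_max_left _ _) h2

end HarnackConst

section Consequences

variable {E : Type*} [NormedAddCommGroup E] [InnerProductSpace ℝ E] [FiniteDimensional ℝ E]
  [MeasurableSpace E]

variable {A R₀ C : ℝ} {Ω : Set E} {T : ℝ} {a : ℝ → E → E} {w : ℝ → E → ℝ}

/-- The integrated equation of the local class on `(0, T] × Ω` in the "`0 < s ≤ t ≤ T`" form of
`KNSS2009_lemma21` / `Lieberman1996_harnack_drift`. [folklore] -/
theorem IsDriftHeatSolutionOn.integral_eq_Ioc (hw : IsDriftHeatSolutionOn a w A (Ioc 0 T) Ω) :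
    ∀ x ∈ Ω, ∀ s t : ℝ, 0 < s → s ≤ t → t ≤ T →
      w t x - w s x = ∫ r in s..t, ((Δ (w r)) x - fderiv ℝ (w r) x (a r x)) :=
  fun x hx s t hs hst htT =>
    hw.integral_eq x hx s ⟨hs, hst.trans htT⟩ t ⟨hs.trans_le hst, htT⟩ hst

/-- The hypotheses of `KNSS2009_lemma21` / `Lieberman1996_harnack_drift` on `(0, T] × Ω` are
exactly membership in the local class `IsDriftHeatSolutionOn a u A (0,T] Ω`. [folklore] -/
theorem isDriftHeatSolutionOn_Ioc_of_hyps {u : ℝ → E → ℝ} (ham : Measurable (uncurry a))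
    (haA : ∀ t ∈ Ioc 0 T, ∀ x ∈ Ω, ‖a t x‖ ≤ A) (hu2 : ∀ t ∈ Ioc 0 T, ContDiffOn ℝ 2 (u t) Ω)
    (hDu : ContinuousOn (fun p : ℝ × E => fderiv ℝ (u p.1) p.2) (Ioc 0 T ×ˢ Ω))
    (hΔu : ContinuousOn (fun p : ℝ × E => (Δ (u p.1)) p.2) (Ioc 0 T ×ˢ Ω))
    (hequ : ∀ x ∈ Ω, ∀ s t : ℝ, 0 < s → s ≤ t → t ≤ T →
      u t x - u s x = ∫ r in s..t, ((Δ (u r)) x - fderiv ℝ (u r) x (a r x))) :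
    IsDriftHeatSolutionOn a u A (Ioc 0 T) Ω where
  measurable_drift := ham
  norm_drift_le := haA
  contDiffOn := hu2
  continuousOn_fderiv := hDu
  continuousOn_laplacian := hΔu
  integral_eq x hx s hs t ht hst := hequ x hx s t hs.1 hst ht.2

/-- **The Harnack inequality for a member of the local class** (unpacking `IsHarnackConstFor`).
[cite: Lieberman1996, Ch. VI Thm 6.27] -/
theorem IsHarnackConstFor.apply (hC : IsHarnackConstFor E A R₀ C) (hΩ : IsOpen Ω)
    (hw : IsDriftHeatSolutionOn a w A (Ioc 0 T) Ω) {y : E} {s R : ℝ} (hR : 0 < R)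
    (hRR₀ : R ≤ R₀) (hB : closedBall y (4 * R) ⊆ Ω) (hs : 16 * R ^ 2 < s) (hsT : s ≤ T)
    (hpos : ∀ t ∈ Ioo (s - 16 * R ^ 2) s, ∀ x ∈ ball y (4 * R), 0 ≤ w t x)
    {t₁ : ℝ} {x₁ : E} {t₂ : ℝ} {x₂ : E} (ht₁ : t₁ ∈ Ioo (s - 5 / 4 * R ^ 2) (s - R ^ 2))
    (hx₁ : x₁ ∈ ball y (R / 2)) (ht₂ : t₂ ∈ Ioo (s - R ^ 2) s) (hx₂ : x₂ ∈ ball y R) :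
    w t₁ x₁ ≤ C * w t₂ x₂ :=
  hC hΩ hw.measurable_drift hw.norm_drift_le hw.contDiffOn hw.continuousOn_fderiv
    hw.continuousOn_laplacian hw.integral_eq_Ioc hR hRR₀ hB hs hsT hpos ht₁ hx₁ ht₂ hx₂

omit [InnerProductSpace ℝ E] [FiniteDimensional ℝ E] [MeasurableSpace E] in
/-- A cylinder `Q((y,s), ρ) = B(y, ρ) × (s − ρ², s)` with `B̄(y, ρ) ⊆ Ω`, `ρ² < s ≤ T` lies in
`(0, T] × Ω`: its points satisfy `t ∈ (0, T]`, `z ∈ Ω`. [folklore] -/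
theorem cyl_mem {y : E} {s ρ : ℝ} (hB : closedBall y ρ ⊆ Ω) (hs : ρ ^ 2 < s) (hsT : s ≤ T)
    {t : ℝ} {z : E} (ht : t ∈ Ioo (s - ρ ^ 2) s) (hz : z ∈ ball y ρ) :
    t ∈ Ioc (0 : ℝ) T ∧ z ∈ Ω :=
  ⟨⟨by linarith [ht.1], ht.2.le.trans hsT⟩, hB (ball_subset_closedBall hz)⟩

/-! ### Oscillation decay on top-aligned cylinders -/

/-- **Oscillation decay, one step** (Lieberman 1996, proof of Theorem 6.28, with the Harnack
inequality of Theorem 6.27): if `m₄ ≤ w ≤ M₄` on `Q((x,s'), 4r) = B(x,4r) × (s' − 16r², s')`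
(`B̄(x,4r) ⊆ Ω`, `16r² < s' ≤ T`, `r ≤ R₀`), then on `Q((x,s'), r)` the oscillation of `w` is at
most `(1 − 1/C)(M₄ − m₄)`: apply Harnack to the nonnegative solutions `M₄ − w` and `w − m₄` between
the point `(x, s' − 9r²/8) ∈ Θ(r/2)` and the points of `Q(r)`. [cite: Lieberman1996, Ch. VI Thm 6.28 (proof)] -/
theorem IsHarnackConstFor.osc_step (hC : IsHarnackConstFor E A R₀ C) (hC1 : 1 ≤ C)
    (hΩ : IsOpen Ω) (hw : IsDriftHeatSolutionOn a w A (Ioc 0 T) Ω) {x : E} {s' r m₄ M₄ : ℝ}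
    (hr : 0 < r) (hrR₀ : r ≤ R₀) (hB : closedBall x (4 * r) ⊆ Ω) (hs : 16 * r ^ 2 < s')
    (hsT : s' ≤ T)
    (hbd : ∀ t ∈ Ioo (s' - 16 * r ^ 2) s', ∀ z ∈ ball x (4 * r), m₄ ≤ w t z ∧ w t z ≤ M₄)
    {t : ℝ} {z : E} {t' : ℝ} {z' : E} (ht : t ∈ Ioo (s' - r ^ 2) s') (hz : z ∈ ball x r)
    (ht' : t' ∈ Ioo (s' - r ^ 2) s') (hz' : z' ∈ ball x r) :
    w t z - w t' z' ≤ (1 - 1 / C) * (M₄ - m₄) := by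
  have hCpos : 0 < C := by linarith
  have hr2 : 0 < r ^ 2 := by positivity
  -- the two nonnegative solutions `M₄ − w` and `w − m₄`
  have hw₁ : IsDriftHeatSolutionOn a (fun t z => -w t z + M₄) A (Ioc 0 T) Ω :=
    hw.neg.add_const hΩ ordConnected_Ioc M₄
  have hw₂ : IsDriftHeatSolutionOn a (fun t z => w t z + -m₄) A (Ioc 0 T) Ω :=
    hw.add_const hΩ ordConnected_Ioc (-m₄)
  have hpos₁ : ∀ t ∈ Ioo (s' - 16 * r ^ 2) s', ∀ z ∈ ball x (4 * r), 0 ≤ -w t z + M₄ :=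
    fun t ht z hz => by linarith [(hbd t ht z hz).2]
  have hpos₂ : ∀ t ∈ Ioo (s' - 16 * r ^ 2) s', ∀ z ∈ ball x (4 * r), 0 ≤ w t z + -m₄ :=
    fun t ht z hz => by linarith [(hbd t ht z hz).1]
  -- the reference point `(x, s' − 9r²/8) ∈ Θ(r/2)`
  have ht₁ : s' - 9 / 8 * r ^ 2 ∈ Ioo (s' - 5 / 4 * r ^ 2) (s' - r ^ 2) := by
    constructor <;> nlinarith
  have hx₁ : x ∈ ball x (r / 2) := mem_ball_self (by positivity)
  have h1 := hC.apply hΩ hw₁ hr hrR₀ hB hs hsT hpos₁ ht₁ hx₁ ht hz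
  have h2 := hC.apply hΩ hw₂ hr hrR₀ hB hs hsT hpos₂ ht₁ hx₁ ht' hz'
  -- combine
  have key : C * (w t z - w t' z') ≤ (C - 1) * (M₄ - m₄) := by nlinarith [h1, h2]
  have hθ : (1 - 1 / C) * (M₄ - m₄) = (C - 1) * (M₄ - m₄) / C := by
    field_simp
  rw [hθ, le_div_iff₀ hCpos]
  linarith [key]

/-- **Oscillation decay, iterated** (Lieberman 1996, Theorem 6.28 via Lemma 4.6, for solutions
of `wₜ + a·∇w − Δw = 0` with `m ≤ w ≤ M` on `(0,T] × Ω`): on the top-aligned cylinders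
`Q((x,s'), ρ/4ʲ)`, `B̄(x, ρ) ⊆ Ω`, `ρ² < s' ≤ T`, `ρ ≤ R₀`, the oscillation of `w` is at most
`(1 − 1/C)ʲ (M − m)`. In particular `w` has a modulus of continuity backwards in time from every
point `(z, t)`, `t ≤ T`, uniform over the class — the interior regularity that KNSS 2009 take
from [LSU] in the proof of Lemma 2.1. [cite: Lieberman1996, Ch. VI Thm 6.28] -/
theorem IsHarnackConstFor.osc_iterate (hC : IsHarnackConstFor E A R₀ C) (hC1 : 1 ≤ C)
    (hΩ : IsOpen Ω) (hw : IsDriftHeatSolutionOn a w A (Ioc 0 T) Ω) {m M : ℝ}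
    (hbd : ∀ t ∈ Ioc 0 T, ∀ z ∈ Ω, m ≤ w t z ∧ w t z ≤ M) {x : E} {s' ρ : ℝ} (hρ : 0 < ρ)
    (hρR₀ : ρ ≤ R₀) (hB : closedBall x ρ ⊆ Ω) (hs : ρ ^ 2 < s') (hsT : s' ≤ T) (j : ℕ)
    {t : ℝ} {z : E} {t' : ℝ} {z' : E} (ht : t ∈ Ioo (s' - (ρ / 4 ^ j) ^ 2) s')
    (hz : z ∈ ball x (ρ / 4 ^ j)) (ht' : t' ∈ Ioo (s' - (ρ / 4 ^ j) ^ 2) s')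
    (hz' : z' ∈ ball x (ρ / 4 ^ j)) :
    w t z - w t' z' ≤ (1 - 1 / C) ^ j * (M - m) := by
  have hθ0 : 0 ≤ 1 - 1 / C := by
    have : 1 / C ≤ 1 := by rw [div_le_one (by linarith)]; exact hC1
    linarith
  induction j generalizing t z t' z' with
  | zero =>
    simp only [pow_zero, div_one, one_mul] at ht hz ht' hz' ⊢
    obtain ⟨htm, hzm⟩ := cyl_mem hB hs hsT ht hz
    obtain ⟨htm', hzm'⟩ := cyl_mem hB hs hsT ht' hz'
    linarith [(hbd t htm z hzm).2, (hbd t' htm' z' hzm').1]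
  | succ j ih =>
    -- the cylinder `Q(ρ/4ʲ) = Q(4r)`, `r = ρ/4ʲ⁺¹`
    set ρj : ℝ := ρ / 4 ^ j with hρj
    set r : ℝ := ρ / 4 ^ (j + 1) with hr
    have hρj_eq : ρj = 4 * r := by
      simp only [hρj, hr, pow_succ]; field_simp
    have hrpos : 0 < r := by positivity
    have hρjpos : 0 < ρj := by positivity
    have hρj_le : ρj ≤ ρ := by
      rw [hρj, div_le_iff₀ (by positivity)]
      have : (1 : ℝ) ≤ 4 ^ j := one_le_pow₀ (by norm_num)
      nlinarith
    have hr_le : r ≤ R₀ := by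
      have : r ≤ ρj := by rw [hρj_eq]; linarith
      exact this.trans (hρj_le.trans hρR₀)
    have hBr : closedBall x (4 * r) ⊆ Ω := by
      rw [← hρj_eq]; exact (closedBall_subset_closedBall hρj_le).trans hB
    have hsr : 16 * r ^ 2 < s' := by
      have h1 : 16 * r ^ 2 = ρj ^ 2 := by rw [hρj_eq]; ring
      have h2 : ρj ^ 2 ≤ ρ ^ 2 := pow_le_pow_left₀ hρjpos.le hρj_le 2
      linarith
    -- the values of `w` on `Q(ρ/4ʲ)` and their extrema
    set V : Set ℝ := (fun p : ℝ × E => w p.1 p.2) '' (Ioo (s' - ρj ^ 2) s' ×ˢ ball x ρj) with hV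
    have hVne : V.Nonempty := by
      have hq : s' - ρj ^ 2 / 2 ∈ Ioo (s' - ρj ^ 2) s' := by
        have : 0 < ρj ^ 2 := by positivity
        constructor <;> linarith
      exact ⟨_, mem_image_of_mem _ (mk_mem_prod hq (mem_ball_self hρjpos))⟩
    have hVmem : ∀ {q : ℝ} {ζ : E}, q ∈ Ioo (s' - ρj ^ 2) s' → ζ ∈ ball x ρj → w q ζ ∈ V :=
      fun hq hζ => mem_image_of_mem (fun p : ℝ × E => w p.1 p.2) (mk_mem_prod hq hζ)
    have hVabove : BddAbove V := by
      refine ⟨M, ?_⟩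
      rintro _ ⟨⟨q, ζ⟩, ⟨hq, hζ⟩, rfl⟩
      have hsj : ρj ^ 2 < s' := lt_of_le_of_lt (pow_le_pow_left₀ hρjpos.le hρj_le 2) hs
      obtain ⟨hqm, hζm⟩ := cyl_mem ((closedBall_subset_closedBall hρj_le).trans hB) hsj hsT hq hζ
      exact (hbd q hqm ζ hζm).2
    have hVbelow : BddBelow V := by
      refine ⟨m, ?_⟩
      rintro _ ⟨⟨q, ζ⟩, ⟨hq, hζ⟩, rfl⟩
      have hsj : ρj ^ 2 < s' := lt_of_le_of_lt (pow_le_pow_left₀ hρjpos.le hρj_le 2) hs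
      obtain ⟨hqm, hζm⟩ := cyl_mem ((closedBall_subset_closedBall hρj_le).trans hB) hsj hsT hq hζ
      exact (hbd q hqm ζ hζm).1
    set M₄ := sSup V with hM₄
    set m₄ := sInf V with hm₄
    -- the induction hypothesis bounds `M₄ − m₄`
    have hdiff : M₄ - m₄ ≤ (1 - 1 / C) ^ j * (M - m) := by
      have h1 : ∀ v ∈ V, v ≤ m₄ + (1 - 1 / C) ^ j * (M - m) := by
        rintro _ ⟨⟨q, ζ⟩, ⟨hq, hζ⟩, rfl⟩
        have h2 : w q ζ - (1 - 1 / C) ^ j * (M - m) ≤ m₄ := by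
          refine le_csInf hVne ?_
          rintro _ ⟨⟨q', ζ'⟩, ⟨hq', hζ'⟩, rfl⟩
          have := ih hq hζ hq' hζ'
          simp only at this ⊢
          linarith
        simp only
        linarith
      have := csSup_le hVne h1
      linarith
    -- bounds on `Q(4r)` and the one-step decay
    have hbd4 : ∀ q ∈ Ioo (s' - 16 * r ^ 2) s', ∀ ζ ∈ ball x (4 * r), m₄ ≤ w q ζ ∧ w q ζ ≤ M₄ := by
      intro q hq ζ hζ
      have h16 : 16 * r ^ 2 = ρj ^ 2 := by rw [hρj_eq]; ring
      rw [h16] at hq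
      rw [← hρj_eq] at hζ
      exact ⟨csInf_le hVbelow (hVmem hq hζ), le_csSup hVabove (hVmem hq hζ)⟩
    have hstep := hC.osc_step hC1 hΩ hw hrpos hr_le hBr hsr hsT hbd4 ht hz ht' hz'
    calc w t z - w t' z' ≤ (1 - 1 / C) * (M₄ - m₄) := hstep
      _ ≤ (1 - 1 / C) * ((1 - 1 / C) ^ j * (M - m)) := mul_le_mul_of_nonneg_left hdiff hθ0
      _ = (1 - 1 / C) ^ (j + 1) * (M - m) := by rw [pow_succ]; ring

/-! ### Harnack chains -/

/-- **Harnack chain** (Lieberman 1996, Ch. VI, Theorem 6.25, "the chaining argument"): for a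
nonnegative solution on `(0,T] × Ω`, points `Z₀, …, Zₙ` with `|Zᵢ₊₁ − Zᵢ| < R` and
`B̄(Zᵢ, 4R) ⊆ Ω`, and times `σ₀, …, σₙ` such that each consecutive pair admits a top `sᵢ ≤ T`,
`16R² < sᵢ`, with `σᵢ ∈ (sᵢ − 5R²/4, sᵢ − R²)` and `σᵢ₊₁ ∈ (sᵢ − R², sᵢ)` (so that
`(Zᵢ, σᵢ) ∈ Θ(R/2)` and `(Zᵢ₊₁, σᵢ₊₁) ∈ Q(R)` for the cylinder centred at `(Zᵢ, sᵢ)`), one has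
`w(σ₀, Z₀) ≤ Cⁿ w(σₙ, Zₙ)`. [cite: Lieberman1996, Ch. VI Thm 6.25 (chaining)] -/
theorem IsHarnackConstFor.chain (hC : IsHarnackConstFor E A R₀ C) (hC0 : 0 ≤ C) (hΩ : IsOpen Ω)
    (hw : IsDriftHeatSolutionOn a w A (Ioc 0 T) Ω) (hw0 : ∀ t ∈ Ioc 0 T, ∀ z ∈ Ω, 0 ≤ w t z)
    {R : ℝ} (hR : 0 < R) (hRR₀ : R ≤ R₀) (Z : ℕ → E) (σ : ℕ → ℝ) (n : ℕ)
    (hZ : ∀ i < n, dist (Z (i + 1)) (Z i) < R) (hZΩ : ∀ i < n, closedBall (Z i) (4 * R) ⊆ Ω)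
    (htop : ∀ i < n, ∃ s : ℝ, 16 * R ^ 2 < s ∧ s ≤ T ∧
      σ i ∈ Ioo (s - 5 / 4 * R ^ 2) (s - R ^ 2) ∧ σ (i + 1) ∈ Ioo (s - R ^ 2) s) :
    w (σ 0) (Z 0) ≤ C ^ n * w (σ n) (Z n) := by
  induction n with
  | zero => simp
  | succ n ih =>
    have h1 := ih (fun i hi => hZ i (by omega)) (fun i hi => hZΩ i (by omega))
      (fun i hi => htop i (by omega))
    obtain ⟨s, hs, hsT, hσ, hσ'⟩ := htop n (by omega)
    have hpos : ∀ t ∈ Ioo (s - 16 * R ^ 2) s, ∀ z ∈ ball (Z n) (4 * R), 0 ≤ w t z := by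
      intro t ht z hz
      have h16 : (4 * R) ^ 2 = 16 * R ^ 2 := by ring
      obtain ⟨htm, hzm⟩ := cyl_mem (T := T) (hZΩ n (by omega)) (by rw [h16]; exact hs) hsT
        (by rw [h16]; exact ht) hz
      exact hw0 t htm z hzm
    have h2 := hC.apply hΩ hw hR hRR₀ (hZΩ n (by omega)) hs hsT hpos hσ
      (mem_ball_self (by positivity)) hσ' (hZ n (by omega))
    calc w (σ 0) (Z 0) ≤ C ^ n * w (σ n) (Z n) := h1
      _ ≤ C ^ n * (C * w (σ (n + 1)) (Z (n + 1))) := mul_le_mul_of_nonneg_left h2 (pow_nonneg hC0 n)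
      _ = C ^ (n + 1) * w (σ (n + 1)) (Z (n + 1)) := by rw [pow_succ]; ring

end Consequences

end Literature.Analysis.FluidPDE

end
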